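import Summits.KontsevichZagierPeriods.KontsevichZagierPeriods.Theorems.SoloBlindLegendreBand
import Literature.NumberTheory.Transcendental.KZIntervalPeriodProofs
import Summits.KontsevichZagierPeriods.KontsevichZagierPeriods.Theorems.SoloBlindAngleBox
import Summits.KontsevichZagierPeriods.KontsevichZagierPeriods.Theorems.SoloBlindBoxExamples
import Summits.KontsevichZagierPeriods.KontsevichZagierPeriods.Theorems.SoloBlindEllipticCells
import HarnessLib

/-!
# Legendre's relation inside the rules, III: representations and the boundary fluxes

With the band `B = (0,1)² × [m₁, m₂]` of `SoloBlindLegendreBand` and `F, G, H` of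
`SoloBlindLegendreForm`: the bounds `|∂G/∂x|, |F| ≤ C/(√(1-x)√(1-y))`, integrability, the
representations — slice `L_μ = [(0,1)², F(·,·,μ)]` (`sliceRep`), difference slice (`diffRep`),
rate `[B, ∂F/∂μ]` (`rateRep`), fluxes `[B_x, ∂G/∂x]`, `[B_y, ∂H/∂y]` (`fluxXRep`, `fluxYRep`),
`zeroRep` — and the first deformation move, rule (3) along the modulus axis
(`rateRep_sub_diffRep`).
-/

noncomputable section

namespace Summit.KontsevichZagierPeriods.KontsevichZagierPeriods.Theorems

open Set MeasureTheory
open Literature.ModelTheory.ExponentialFields (IsSemialgebraic)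
open Literature.NumberTheory.Transcendental
open Literature.NumberTheory.Transcendental.KZ

namespace SoloBlind

section Representations

variable (c : ModBand)

/-! ## The bounds -/

section bounds

variable {x y μ lo hi : ℝ}

/-- `√u = √(1-x²) √(1-μx²) √(1-y²) √(1-(1-μ)y²)` on the relevant range. -/
theorem legT_eq_prod (hx : x ^ 2 < 1) (hy : y ^ 2 < 1) (hμ : μ ∈ Icc (0:ℝ) 1) :
    legT x y μ = Real.sqrt (1 - x ^ 2) * Real.sqrt (1 - μ * x ^ 2) * Real.sqrt (1 - y ^ 2) *
      Real.sqrt (1 - (1 - μ) * y ^ 2) := by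
  have hP : 0 ≤ 1 - x ^ 2 := (sub_pos.mpr hx).le
  have hQ : 0 ≤ 1 - μ * x ^ 2 := by nlinarith [hμ.1, hμ.2, sq_nonneg x]
  have hR : 0 ≤ 1 - y ^ 2 := (sub_pos.mpr hy).le
  rw [legT, legU, Real.sqrt_mul (mul_nonneg (mul_nonneg hP hQ) hR), Real.sqrt_mul
    (mul_nonneg hP hQ), Real.sqrt_mul hP]

/-- **The flux bound**: for `x, y ∈ (0,1)` and `μ ∈ [m₁, m₂] ⊆ (0,1)`,
`|∂G/∂x| ≤ 1/(2(1-m₂)√(1-m₂)√m₁ · √(1-x) √(1-y))`. -/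
theorem abs_legGx_le (hx : x ∈ Ioo (0:ℝ) 1) (hy : y ∈ Ioo (0:ℝ) 1) (hlo : 0 < lo)
    (hhi : hi < 1) (hμ : μ ∈ Icc lo hi) :
    |legGx x y μ| ≤ 1 / (2 * (1 - hi) * Real.sqrt (1 - hi) * Real.sqrt lo *
      Real.sqrt (1 - x) * Real.sqrt (1 - y)) := by
  have hx2 : x ^ 2 < 1 := by nlinarith [hx.1, hx.2]
  have hy2 : y ^ 2 < 1 := by nlinarith [hy.1, hy.2]
  have hμ0 : 0 ≤ μ := hlo.le.trans hμ.1
  have hμ1 : μ ≤ 1 := hμ.2.trans hhi.le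
  have hP : 0 < 1 - x ^ 2 := sub_pos.mpr hx2
  have hQ : 1 - hi ≤ 1 - μ * x ^ 2 := by nlinarith [hμ.2, sq_nonneg x]
  have hQ0 : 0 < 1 - μ * x ^ 2 := (sub_pos.mpr hhi).trans_le hQ
  have hR : 0 < 1 - y ^ 2 := sub_pos.mpr hy2
  have hS : lo ≤ 1 - (1 - μ) * y ^ 2 := by nlinarith [hμ.1, sq_nonneg y]
  have hS0 : 0 < 1 - (1 - μ) * y ^ 2 := hlo.trans_le hS
  have hU : 0 < legU x y μ := legU_pos hx2 hy2 ⟨hμ0, hμ1⟩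
  have hT : 0 < legT x y μ := legT_pos hx2 hy2 ⟨hμ0, hμ1⟩
  have hW : |1 - 2 * x ^ 2 + μ * x ^ 4| ≤ 1 := by
    have h4 : x ^ 4 = x ^ 2 * x ^ 2 := by ring
    refine abs_le.mpr ⟨by nlinarith [sq_nonneg x, mul_nonneg hμ0 (sq_nonneg (x ^ 2))], ?_⟩
    nlinarith [mul_le_mul hμ1 (le_refl (x ^ 4)) (by positivity) zero_le_one,
      mul_le_mul hx2.le (le_refl (x ^ 2)) (sq_nonneg x) zero_le_one]
  -- `|∂G/∂x| ≤ 1/(2 Q t)`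
  have h1 : |legGx x y μ| ≤ 1 / (2 * (1 - μ * x ^ 2) * legT x y μ) := by
    rw [legGx, abs_div, abs_of_pos (mul_pos (mul_pos two_pos hU) hT), abs_mul,
      abs_of_nonneg (by positivity :
        0 ≤ y ^ 2 * (1 - x ^ 2) * (1 - y ^ 2) * (1 - (1 - μ) * y ^ 2)),
      div_le_div_iff₀ (mul_pos (mul_pos two_pos hU) hT) (mul_pos (mul_pos two_pos hQ0) hT),
      legU]
    have hy1 : y ^ 2 ≤ 1 := hy2.le
    nlinarith [mul_le_mul hy1 hW (abs_nonneg _) zero_le_one, hT, mul_pos (mul_pos hP hR) hS0,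
      mul_pos (mul_pos (mul_pos hP hR) hS0) (mul_pos hQ0 hT),
      mul_nonneg (mul_nonneg (sq_nonneg y) (abs_nonneg (1 - 2 * x ^ 2 + μ * x ^ 4)))
        (mul_pos (mul_pos (mul_pos hP hR) hS0) (mul_pos hQ0 hT)).le]
  refine h1.trans (one_div_le_one_div_of_le (by
    have := sub_pos.mpr hhi; have := sub_pos.mpr hx.2; have := sub_pos.mpr hy.2
    positivity) ?_)
  -- `2(1-m₂)√(1-m₂)√m₁ √(1-x) √(1-y) ≤ 2 Q √P √Q √R √S`
  rw [legT_eq_prod hx2 hy2 ⟨hμ0, hμ1⟩]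
  have i1 : Real.sqrt (1 - hi) ≤ Real.sqrt (1 - μ * x ^ 2) := Real.sqrt_le_sqrt hQ
  have i2 : Real.sqrt lo ≤ Real.sqrt (1 - (1 - μ) * y ^ 2) := Real.sqrt_le_sqrt hS
  have i3 : Real.sqrt (1 - x) ≤ Real.sqrt (1 - x ^ 2) :=
    Real.sqrt_le_sqrt (by nlinarith [hx.1, hx.2])
  have i4 : Real.sqrt (1 - y) ≤ Real.sqrt (1 - y ^ 2) :=
    Real.sqrt_le_sqrt (by nlinarith [hy.1, hy.2])
  calc 2 * (1 - hi) * Real.sqrt (1 - hi) * Real.sqrt lo * Real.sqrt (1 - x) * Real.sqrt (1 - y)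
      = 2 * ((1 - hi) * (Real.sqrt (1 - hi) * (Real.sqrt lo * (Real.sqrt (1 - x) *
          Real.sqrt (1 - y))))) := by ring
    _ ≤ 2 * ((1 - μ * x ^ 2) * (Real.sqrt (1 - μ * x ^ 2) * (Real.sqrt (1 - (1 - μ) * y ^ 2) *
          (Real.sqrt (1 - x ^ 2) * Real.sqrt (1 - y ^ 2))))) := by
        refine mul_le_mul_of_nonneg_left (mul_le_mul hQ (mul_le_mul i1 (mul_le_mul i2
          (mul_le_mul i3 i4 (Real.sqrt_nonneg _) (Real.sqrt_nonneg _)) (by positivity)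
          (Real.sqrt_nonneg _)) (by positivity) (Real.sqrt_nonneg _)) (by positivity) hQ0.le)
          zero_le_two
    _ = 2 * (1 - μ * x ^ 2) * (Real.sqrt (1 - x ^ 2) * Real.sqrt (1 - μ * x ^ 2) *
          Real.sqrt (1 - y ^ 2) * Real.sqrt (1 - (1 - μ) * y ^ 2)) := by ring

/-- **The form bound**: for `x, y ∈ (0,1)` and `μ ∈ (0,1)`,
`|F| ≤ 1/(√(1-μ) √μ √(1-x) √(1-y))`. -/
theorem abs_legF_le (hx : x ∈ Ioo (0:ℝ) 1) (hy : y ∈ Ioo (0:ℝ) 1)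
    (hμ : μ ∈ Ioo (0:ℝ) 1) : |legF x y μ| ≤
      1 / (Real.sqrt (1 - μ) * Real.sqrt μ * Real.sqrt (1 - x) * Real.sqrt (1 - y)) := by
  have hx2 : x ^ 2 < 1 := by nlinarith [hx.1, hx.2]
  have hy2 : y ^ 2 < 1 := by nlinarith [hy.1, hy.2]
  have hP : 0 < 1 - x ^ 2 := sub_pos.mpr hx2
  have hQ : 1 - μ ≤ 1 - μ * x ^ 2 := by nlinarith [hμ.1, sq_nonneg x]
  have hR : 0 < 1 - y ^ 2 := sub_pos.mpr hy2
  have hS : μ ≤ 1 - (1 - μ) * y ^ 2 := by nlinarith [hμ.2, sq_nonneg y]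
  have hT : 0 < legT x y μ := legT_pos hx2 hy2 ⟨hμ.1.le, hμ.2.le⟩
  have h1 : |legF x y μ| ≤ 1 / legT x y μ := by
    rw [legF, abs_div, abs_of_pos hT]
    refine div_le_div_of_nonneg_right (abs_le.mpr ⟨?_, ?_⟩) hT.le
    · nlinarith [mul_nonneg hμ.1.le hP.le, mul_nonneg (sub_pos.mpr hμ.2).le hR.le]
    · nlinarith [mul_nonneg hμ.1.le (sq_nonneg x),
        mul_nonneg (sub_pos.mpr hμ.2).le (sq_nonneg y)]
  refine h1.trans (one_div_le_one_div_of_le (by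
    have := sub_pos.mpr hμ.2; have := sub_pos.mpr hx.2; have := sub_pos.mpr hy.2
    have := hμ.1
    positivity) ?_)
  rw [legT_eq_prod hx2 hy2 ⟨hμ.1.le, hμ.2.le⟩]
  have i1 : Real.sqrt (1 - μ) ≤ Real.sqrt (1 - μ * x ^ 2) := Real.sqrt_le_sqrt hQ
  have i2 : Real.sqrt μ ≤ Real.sqrt (1 - (1 - μ) * y ^ 2) := Real.sqrt_le_sqrt hS
  have i3 : Real.sqrt (1 - x) ≤ Real.sqrt (1 - x ^ 2) :=
    Real.sqrt_le_sqrt (by nlinarith [hx.1, hx.2])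
  have i4 : Real.sqrt (1 - y) ≤ Real.sqrt (1 - y ^ 2) :=
    Real.sqrt_le_sqrt (by nlinarith [hy.1, hy.2])
  calc Real.sqrt (1 - μ) * Real.sqrt μ * Real.sqrt (1 - x) * Real.sqrt (1 - y)
      = Real.sqrt (1 - μ) * (Real.sqrt μ * (Real.sqrt (1 - x) * Real.sqrt (1 - y))) := by ring
    _ ≤ Real.sqrt (1 - μ * x ^ 2) * (Real.sqrt (1 - (1 - μ) * y ^ 2) *
          (Real.sqrt (1 - x ^ 2) * Real.sqrt (1 - y ^ 2))) :=
        mul_le_mul i1 (mul_le_mul i2 (mul_le_mul i3 i4 (Real.sqrt_nonneg _)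
          (Real.sqrt_nonneg _)) (by positivity) (Real.sqrt_nonneg _)) (by positivity)
          (Real.sqrt_nonneg _)
    _ = Real.sqrt (1 - x ^ 2) * Real.sqrt (1 - μ * x ^ 2) * Real.sqrt (1 - y ^ 2) *
          Real.sqrt (1 - (1 - μ) * y ^ 2) := by ring

end bounds

/-! ## Integrability of the four integrands -/

/-- `∂G/∂x` is integrable on the band. -/
theorem integrableOn_legGx_band : IntegrableOn (fun z : Fin 3 → ℝ => legGx (z 0) (z 1) (z 2))
    (band c) := by
  refine integrableOn_band_of_le c (by unfold legGx legT legU; fun_prop)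
    (1 / (2 * (1 - c.hi) * Real.sqrt (1 - c.hi) * Real.sqrt c.lo)) fun z hz => ?_
  refine (abs_legGx_le hz.1.1 hz.1.2 c.lo_pos c.hi_lt_one hz.2).trans (le_of_eq ?_)
  have := sub_pos.mpr c.hi_lt_one; have := sub_pos.mpr hz.1.1.2; have := sub_pos.mpr hz.1.2.2
  have := c.lo_pos
  field_simp

/-- `∂H/∂y` is integrable on the band (by the symmetry `(x,y,μ) ↔ (y,x,1-μ)`). -/
theorem integrableOn_legHy_band : IntegrableOn (fun z : Fin 3 → ℝ => legHy (z 0) (z 1) (z 2))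
    (band c) := by
  refine integrableOn_band_of_le c (by unfold legHy legT legU; fun_prop)
    (1 / (2 * c.lo * Real.sqrt c.lo * Real.sqrt (1 - c.hi))) fun z hz => ?_
  have hμ : 1 - z 2 ∈ Icc (1 - c.hi) (1 - c.lo) :=
    ⟨by linarith [hz.2.2], by linarith [hz.2.1]⟩
  rw [legHy_eq, abs_neg]
  refine (abs_legGx_le hz.1.2 hz.1.1 (sub_pos.mpr c.hi_lt_one) (sub_lt_self _ c.lo_pos)
    hμ).trans (le_of_eq ?_)
  have := sub_pos.mpr c.hi_lt_one; have := sub_pos.mpr hz.1.1.2; have := sub_pos.mpr hz.1.2.2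
  have := c.lo_pos
  rw [sub_sub_cancel]
  field_simp

/-- `∂F/∂μ = ∂G/∂x + ∂H/∂y` is integrable on the band. -/
theorem integrableOn_legFμ_band : IntegrableOn (fun z : Fin 3 → ℝ => legFμ (z 0) (z 1) (z 2))
    (band c) :=
  (integrableOn_legGx_band c).add (integrableOn_legHy_band c)

/-- The Legendre form `F(·,·,μ)` is integrable on the open square for `μ ∈ (0,1)`. -/
theorem integrableOn_legF_usq {μ : ℝ} (hμ : μ ∈ Ioo (0:ℝ) 1) :
    IntegrableOn (fun w : Fin 2 → ℝ => legF (w 0) (w 1) μ) usq := by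
  refine integrableOn_usq_of_le (by unfold legF legT legU; fun_prop)
    (1 / (Real.sqrt (1 - μ) * Real.sqrt μ)) fun w hw => ?_
  refine (abs_legF_le hw.1 hw.2 hμ).trans (le_of_eq ?_)
  have := sub_pos.mpr hμ.2; have := sub_pos.mpr hw.1.2; have := sub_pos.mpr hw.2.2
  have := hμ.1
  field_simp

/-! ## Coordinates as semialgebraic functions -/

/-! ## The representations -/

/-- The **slice** `L_μ = [(0,1)², F(·,·,μ)]` for an algebraic `μ ∈ (0,1)`. -/
def sliceRep (μ : ℝ) (hμ : IsAlgebraic ℚ μ) (h : μ ∈ Ioo (0:ℝ) 1) : IntegralRep 2 where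
  domain := usq
  integrand := fun w => legF (w 0) (w 1) μ
  isSemialgebraic_domain := isSemialgebraic_usq
  isSemialgebraicFunOn_integrand := isSemialgebraicFunOn_legF
    (isSemialgebraicFunOn_apply isSemialgebraic_usq 0) (isSemialgebraicFunOn_apply
    isSemialgebraic_usq 1) (isSemialgebraicFunOn_const_of_isAlgebraic isSemialgebraic_usq hμ)
  integrableOn := integrableOn_legF_usq h

/-- The domain of a slice. -/
@[simp] theorem sliceRep_domain (μ : ℝ) (hμ : IsAlgebraic ℚ μ) (h : μ ∈ Ioo (0:ℝ) 1) :
    (sliceRep μ hμ h).domain = usq := rfl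

/-- The integrand of a slice. -/
@[simp] theorem sliceRep_integrand (μ : ℝ) (hμ : IsAlgebraic ℚ μ) (h : μ ∈ Ioo (0:ℝ) 1) :
    (sliceRep μ hμ h).integrand = fun w => legF (w 0) (w 1) μ := rfl

/-- The **difference slice** `[(0,1)², F(·,·,m₂) - F(·,·,m₁)]`. -/
def diffRep : IntegralRep 2 where
  domain := usq
  integrand := fun w => legF (w 0) (w 1) c.hi - legF (w 0) (w 1) c.lo
  isSemialgebraic_domain := isSemialgebraic_usq
  isSemialgebraicFunOn_integrand :=
    (sliceRep c.hi c.hi_alg (c.mem_Ioo (right_mem_Icc.mpr c.lo_le_hi))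
      ).isSemialgebraicFunOn_integrand.sub_holds
    (sliceRep c.lo c.lo_alg (c.mem_Ioo (left_mem_Icc.mpr c.lo_le_hi))
      ).isSemialgebraicFunOn_integrand
  integrableOn := (integrableOn_legF_usq (c.mem_Ioo (right_mem_Icc.mpr c.lo_le_hi))).sub
    (integrableOn_legF_usq (c.mem_Ioo (left_mem_Icc.mpr c.lo_le_hi)))

/-- The **rate** `[B, ∂F/∂μ]`. -/
def rateRep : IntegralRep 3 where
  domain := band c
  integrand := fun z => legFμ (z 0) (z 1) (z 2)
  isSemialgebraic_domain := isSemialgebraic_band c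
  isSemialgebraicFunOn_integrand := isSemialgebraicFunOn_legFμ
    (isSemialgebraicFunOn_apply (isSemialgebraic_band c) 0)
    (isSemialgebraicFunOn_apply (isSemialgebraic_band c) 1)
    (isSemialgebraicFunOn_apply (isSemialgebraic_band c) 2)
  integrableOn := integrableOn_legFμ_band c

/-- The **`x`-flux** `[B_x, ∂G/∂x]` (band closed in `x`). -/
def fluxXRep : IntegralRep 3 where
  domain := bandX c
  integrand := fun z => legGx (z 0) (z 1) (z 2)
  isSemialgebraic_domain := isSemialgebraic_bandX c
  isSemialgebraicFunOn_integrand := isSemialgebraicFunOn_legGx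
    (isSemialgebraicFunOn_apply (isSemialgebraic_bandX c) 0)
    (isSemialgebraicFunOn_apply (isSemialgebraic_bandX c) 1)
    (isSemialgebraicFunOn_apply (isSemialgebraic_bandX c) 2)
  integrableOn := (integrableOn_legGx_band c).congr_set_ae (bandX_ae_eq c)

/-- The **`y`-flux** `[B_y, ∂H/∂y]` (band closed in `y`). -/
def fluxYRep : IntegralRep 3 where
  domain := bandY c
  integrand := fun z => legHy (z 0) (z 1) (z 2)
  isSemialgebraic_domain := isSemialgebraic_bandY c
  isSemialgebraicFunOn_integrand := isSemialgebraicFunOn_legHy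
    (isSemialgebraicFunOn_apply (isSemialgebraic_bandY c) 0)
    (isSemialgebraicFunOn_apply (isSemialgebraic_bandY c) 1)
    (isSemialgebraicFunOn_apply (isSemialgebraic_bandY c) 2)
  integrableOn := (integrableOn_legHy_band c).congr_set_ae (bandY_ae_eq c)

/-- The `x`-flux restricted to the band. -/
def fluxXRepB : IntegralRep 3 :=
  (fluxXRep c).restrict (band c) (isSemialgebraic_band c) (band_subset_bandX c)

/-- The `y`-flux restricted to the band. -/
def fluxYRepB : IntegralRep 3 :=
  (fluxYRep c).restrict (band c) (isSemialgebraic_band c) (band_subset_bandY c)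

/-- The **zero representation** `[(0,1) × [m₁, m₂], 0]` on the flux base. -/
def zeroRep : IntegralRep 2 where
  domain := base c
  integrand := fun _ => 0
  isSemialgebraic_domain := isSemialgebraic_base c
  isSemialgebraicFunOn_integrand :=
    isSemialgebraicFunOn_const_of_isAlgebraic (isSemialgebraic_base c) isAlgebraic_zero
  integrableOn := integrableOn_zero

/-- `[B_x, ∂G/∂x]` and its restriction to `B` differ by a relation (a null modification). -/
theorem fluxXRep_sub_fluxXRepB : of (fluxXRep c) - of (fluxXRepB c) ∈ relations :=
  (fluxXRep c).of_sub_of_restrict_mem_relations (isSemialgebraic_band c) (band_subset_bandX c)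
    (volume_bandX_diff c)

/-- `[B_y, ∂H/∂y]` and its restriction to `B` differ by a relation. -/
theorem fluxYRep_sub_fluxYRepB : of (fluxYRep c) - of (fluxYRepB c) ∈ relations :=
  (fluxYRep c).of_sub_of_restrict_mem_relations (isSemialgebraic_band c) (band_subset_bandY c)
    (volume_bandY_diff c)

/-- **Rule (1) on the band**: `[B, ∂F/∂μ] - [B, ∂G/∂x] - [B, ∂H/∂y]` is a relation, the
integrands adding up *by definition* of `legFμ`. -/
theorem rateRep_sub_fluxes :
    of (rateRep c) - of (fluxXRepB c) - of (fluxYRepB c) ∈ relations :=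
  integrandAddRel_subset_relations ⟨3, rateRep c, fluxXRepB c, fluxYRepB c, rfl, rfl,
    fun _ _ => rfl, rfl⟩

/-- **Rule (1) on the square**: `L_{m₂} - [(0,1)², F_{m₂} - F_{m₁}] - L_{m₁}` is a relation. -/
theorem slice_sub_diffRep_sub_slice :
    of (sliceRep c.hi c.hi_alg (c.mem_Ioo (right_mem_Icc.mpr c.lo_le_hi))) - of (diffRep c) -
      of (sliceRep c.lo c.lo_alg (c.mem_Ioo (left_mem_Icc.mpr c.lo_le_hi))) ∈ relations :=
  integrandAddRel_subset_relations ⟨2, sliceRep c.hi c.hi_alg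
      (c.mem_Ioo (right_mem_Icc.mpr c.lo_le_hi)), diffRep c, sliceRep c.lo c.lo_alg
      (c.mem_Ioo (left_mem_Icc.mpr c.lo_le_hi)), rfl, rfl, fun w _ => by simp [diffRep], rfl⟩

/-- The zero representation is a relation. -/
theorem zeroRep_mem : of (zeroRep c) ∈ relations :=
  of_mem_relations_of_eqOn_zero (zeroRep c) fun _ _ => rfl

end Representations

/-- The domain of a product of two line representations over `(0,1)` is the open square. -/
theorem prod_domain_eq_usq (r s : IntegralRep 1) (hr : r.domain = line (Ioo (0:ℝ) 1))
    (hs : s.domain = line (Ioo (0:ℝ) 1)) : (r.prod s).domain = usq := by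
  ext z
  simp only [IntegralRep.prod_domain, IntegralRep.mem_prodDomain, hr, hs, mem_line, mem_Ioo, usq,
    mem_setOf_eq, (show (Fin.castAdd 1 (0 : Fin 1) : Fin 2) = 0 from rfl),
    (show (Fin.natAdd 1 (0 : Fin 1) : Fin 2) = 1 from rfl)]

section Deformation

variable (c : ModBand)

/-! ## Rule (3) from `ℝ³` to `ℝ²` with constant limits -/

/-- **Newton–Leibniz `3 → 2` with constant limits.** If `F(v₀, v₁, ·)` is continuous on `[a,b]`
with derivative `g(v₀, v₁, ·)` on `(a,b)` for every `v` in the base, `r = [base × [a,b], g]` and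
`r' = [base, F(·,·,b) - F(·,·,a)]`, then `[r] - [r']` is one move of rule (3). -/
theorem nl_three (r : IntegralRep 3) (r' : IntegralRep 2) {a b : ℝ} (ha : IsAlgebraic ℚ a)
    (hb : IsAlgebraic ℚ b) (hab : a ≤ b) (F g : ℝ → ℝ → ℝ → ℝ)
    (hF : IsSemialgebraicFunOn ℚ r.domain fun z => F (z 0) (z 1) (z 2))
    (hint : ∀ z, r.integrand z = g (z 0) (z 1) (z 2))
    (hdom : ∀ z, z ∈ r.domain ↔ (Fin.init z ∈ r'.domain ∧ a ≤ z 2 ∧ z 2 ≤ b))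
    (hcont : ∀ v ∈ r'.domain, ContinuousOn (fun t => F (v 0) (v 1) t) (Icc a b))
    (hder : ∀ v ∈ r'.domain, ∀ t ∈ Ioo a b,
      HasDerivAt (fun s => F (v 0) (v 1) s) (g (v 0) (v 1) t) t)
    (hval : ∀ v ∈ r'.domain, r'.integrand v = F (v 0) (v 1) b - F (v 0) (v 1) a) :
    of r - of r' ∈ relations := by
  have e0 : ∀ (v : Fin 2 → ℝ) (t : ℝ), (Fin.snoc v t : Fin 3 → ℝ) 0 = v 0 := fun _ _ => rfl
  have e1 : ∀ (v : Fin 2 → ℝ) (t : ℝ), (Fin.snoc v t : Fin 3 → ℝ) 1 = v 1 := fun _ _ => rfl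
  have e2 : ∀ (v : Fin 2 → ℝ) (t : ℝ), (Fin.snoc v t : Fin 3 → ℝ) 2 = t := fun _ _ => rfl
  refine newtonLeibnizRel_subset_relations ⟨2, r, r', fun _ => a, fun _ => b,
    fun z => F (z 0) (z 1) (z 2), hF,
    isSemialgebraicFunOn_const_of_isAlgebraic r'.isSemialgebraic_domain ha,
    isSemialgebraicFunOn_const_of_isAlgebraic r'.isSemialgebraic_domain hb,
    fun _ _ => hab, ?_, ?_, ?_, ?_, rfl⟩
  · ext z
    exact hdom z
  · intro v hv
    simp only [e0, e1, e2]
    exact hcont v hv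
  · intro v hv t ht
    simp only [hint, e0, e1, e2]
    exact hder v hv t ht
  · intro v hv
    simp only [e0, e1, e2]
    exact hval v hv

/-! ## Move 1: rule (3) along the modulus axis -/

/-- `[B, ∂F/∂μ] - [(0,1)², F_{m₂} - F_{m₁}]` is one move of rule (3), primitive `F`. -/
theorem rateRep_sub_diffRep : of (rateRep c) - of (diffRep c) ∈ relations := by
  refine nl_three (rateRep c) (diffRep c) c.lo_alg c.hi_alg c.lo_le_hi legF legFμ
    (isSemialgebraicFunOn_legF (isSemialgebraicFunOn_apply (isSemialgebraic_band c) 0)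
      (isSemialgebraicFunOn_apply (isSemialgebraic_band c) 1)
      (isSemialgebraicFunOn_apply (isSemialgebraic_band c) 2))
    (fun _ => rfl) (fun _ => Iff.rfl) (fun v hv => ?_) (fun v hv t ht => ?_) (fun _ _ => rfl)
  · exact (continuousOn_legF (by nlinarith [hv.1.1, hv.1.2]) (by nlinarith [hv.2.1, hv.2.2])
      ).mono (Icc_subset_Icc c.lo_pos.le c.hi_lt_one.le)
  · exact hasDerivAt_legF (by nlinarith [hv.1.1, hv.1.2]) (by nlinarith [hv.2.1, hv.2.2])
      ⟨c.lo_pos.le.trans ht.1.le, ht.2.le.trans c.hi_lt_one.le⟩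

/-! ## Moves 3: the boundary fluxes -/

/-- The permutation to the `x`-flux layout `(y, μ, x)`: `z = (w 2, w 0, w 1)`. -/
def eX : Fin 3 ≃ Fin 3 := (finRotate 3).symm

/-- The permutation to the `y`-flux layout `(x, μ, y)`: `z = (w 0, w 2, w 1)`. -/
def eY : Fin 3 ≃ Fin 3 := Equiv.swap 1 2

/-- Values of `eX`. -/
theorem eX_apply : eX 0 = 2 ∧ eX 1 = 0 ∧ eX 2 = 1 := by unfold eX; decide

/-- Values of `eY`. -/
theorem eY_apply : eY 0 = 0 ∧ eY 1 = 2 ∧ eY 2 = 1 := by unfold eY; decide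

end Deformation

end SoloBlind

end Summit.KontsevichZagierPeriods.KontsevichZagierPeriods.Theorems
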